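import Summits.Ventures.LatticeQCDFlow.Scaling.SwapLadderIndexTauIntThreshold
import Summits.Ventures.LatticeQCDFlow.Scaling.SwapLadderIndexTauIntThresholdPoints
import Summits.Ventures.LatticeQCDFlow.Scaling.SwapLadderIndexTauIntThresholdMinorant

/-!
HONEST FRAMING: exact (Metropolis-corrected) sampling algorithms for lattice gauge theory; figures
of merit are autocorrelation/cost numbers at stated couplings and volumes; no continuum-physics
claim.

# SwapLadderIndexTauIntThresholdCollapse — A LINEAR LOWER BOUND ON THE COLLAPSE THRESHOLD, `Λ_c(K) ≥ 4√2·(0.15772·(K+1) − 1)`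
# FOR `K ≥ 20` (SO `Λ_c(K) = Θ(K)`), AND ITS CONSEQUENCE: A FLAT LADDER TUNED TO `≥ 75 %` PAIR ACCEPTANCE WITH `K ≥ 20` GAPS
# IS BELOW THE THRESHOLD — ITS `τ_int`-OPTIMAL REPLICA SET MERGES REPLICAS (row 22 `su3-ptbc`, GEN-8, ours; sequel of
# `SwapLadderIndexTauIntThreshold`, `…ThresholdPoints`, `…ThresholdMinorant`)

Venture `LatticeQCDFlow` (cell pub-lqcd), topic `Scaling`; FANOUT row 22 (`su3-ptbc`).  NEW WORK of the cell over
`SwapLadderIndexTauIntCritGap` (`critGap`, `deriv_le_iff_le_critGap`, `deriv_critGap_eq`, `critGap_mono`, `critGap_nonneg`,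
`maxPassageWeight`, `Λ_c = thresholdStiffness`), `SwapLadderIndexTauIntThreshold` (`exists_gap_eq_zero_of_le_thresholdStiffness`,
`not_isMinOn_of_le_thresholdStiffness`), `SwapLadderIndexTauIntThresholdPoints` (`deriv_gaussInvAcc_ray`), the Mathlib-only
`SwapLadderIndexTauIntThresholdMinorant` (`indexMinorant` =: `m`, band bounds, `sum_indexMinorant_ge`), GEN-4's `SwapSpacingBrackets`
(`erf_le_partialSum_odd`, `partialSum_even_le_erf`, `two_div_sqrt_pi_lt`, `lt_two_div_sqrt_pi`, `erfc_eq_one_sub`) and Mathlib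
(`Real.sum_le_exp_of_nonneg`).  Nothing is cited as a fact; no `native_decide`.

THE POINT (model statements, value-free).  `SwapLadderIndexTauIntThresholdAllK` bounds the collapse threshold from ABOVE
(`Λ_c(K) ≤ 4√2·0.3711·(K+1)`).  Here it is bounded from BELOW:
* §1 six certified LOWER points **`G′(2√2·x) < R·G′(0)`** at `(R, x) = (1.21, 0.08), (1.61, 0.2), (2.32, 0.35), (3.43, 0.5),
  (8, 0.8), (15, 1)` (odd Maclaurin sums bound `erf` from above; `e^{x²} ≥ Σ_{i<5} x^{2i}/i!`), so `critGap R > 2√2·x`;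
* §2 `maxPassageWeight_ge` (`w_max ≥ ((K+1)² − 1)/4`), so `(w_max/w_j)² ≥ η_K·(4t(1−t))^{−2}`, `t = (j+1)/(K+1)`,
  `η_K = (1 − (K+1)^{−2})² ≥ (440/441)²` for `K ≥ 20`; band by band this gives **`two_sqrt_two_mul_minorant_le_critGap`**:
  `2√2·m(t) ≤ critGap((w_max/w_j)²)` (and `m(1 − t)` likewise, one of the two being `0`);
* §3 **`thresholdStiffness_ge_linear`**: `Λ_c(K) ≥ 4√2·(0.15772·(K+1) − 1)` for `K ≥ 20` (reflection `j ↦ K−1−j` + the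
  minorant's Riemann bound); with `…AllK`: `0.89 ≲ Λ_c(K)/(K+1) ≲ 2.1` — the threshold is LINEAR in the replica number;
* §4 `erfc_023_lt` (`erfc 0.23 < 3/4`), `gap_lt_of_gaussAcc_ge` (model acceptance `≥ 3/4` ⇒ gap `< 2√2·0.23`), and
  **`sum_gap_le_thresholdStiffness_of_acc_ge`**: for `K ≥ 20` gaps all with model acceptance `≥ 3/4`, `Σ_j ℓ_j ≤ Λ_c(K)`; hence
  **`collapse_of_acc_ge`**: no positive `τ_int`-optimal gap vector with that `K` and total stiffness exists, and every
  closed-simplex minimiser has a zero gap (`SwapLadderIndexTauIntThreshold`) — an over-resolved ladder (many replicas at high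
  acceptance) is in the collapse regime of the replica-index `τ_int`.  The card's `20 %` ladders sit far on the other side
  (`…ThresholdCard`, `…AllK`, `…Band`).
NOT CLAIMED: the sharp constant (desk value `Λ_c(K)/K → ≈ 1.3`: collapse above `≈ 52 %` flat acceptance for large `K`);
anything about PTBC or a run; that high-acceptance ladders are otherwise wrong (round trips are a different functional).
-/

noncomputable section

open Finset Real
open Literature.Analysis.SpecialFunctions (erf erfTerm)
open Literature.ComputerArithmetic.BrentZimmermann2010.AsymptoticExpansions (erfc erfc_pos)

namespace Summit.Ventures.LatticeQCDFlow.Scaling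

/-! ## §1 Lower certified points `G′(2√2·x) < R·G′(0)` -/

section LowerPoints

/-- Route: floors `0 ≤ L ≤ erfc x`, `0 < E ≤ e^{x²}` and the check `1 < R·L²·E` give `e^{−x²} < R·erfc(x)²`. [ours] -/
theorem exp_neg_lt_mul_erfc_sq {R x L E : ℝ} (hR : 0 ≤ R) (hL0 : 0 ≤ L) (hL : L ≤ erfc x) (hE0 : 0 < E)
    (hE : E ≤ exp (x ^ 2)) (h : 1 < R * L ^ 2 * E) : exp (-(x ^ 2)) < R * erfc x ^ 2 := by
  have h2 : L ^ 2 ≤ erfc x ^ 2 := pow_le_pow_left₀ hL0 hL 2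
  have h3 : R * L ^ 2 * E ≤ R * erfc x ^ 2 * exp (x ^ 2) :=
    mul_le_mul (mul_le_mul_of_nonneg_left h2 hR) hE hE0.le (by positivity)
  have h4 : 1 < R * erfc x ^ 2 * exp (x ^ 2) := h.trans_le h3
  have hexp : 0 < exp (-(x ^ 2)) := exp_pos _
  have hE1 : exp (x ^ 2) * exp (-(x ^ 2)) = 1 := by rw [← exp_add, add_neg_cancel, exp_zero]
  calc exp (-(x ^ 2)) = 1 * exp (-(x ^ 2)) := (one_mul _).symm
    _ < R * erfc x ^ 2 * exp (x ^ 2) * exp (-(x ^ 2)) := mul_lt_mul_of_pos_right h4 hexp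
    _ = R * erfc x ^ 2 := by rw [mul_assoc, hE1, mul_one]

/-- `e^{−x²} < R·erfc(x)²` gives `G′(2√2·x) < R·G′(0)`. [ours] -/
theorem deriv_ray_lt {R x : ℝ} (h : exp (-(x ^ 2)) < R * erfc x ^ 2) :
    deriv gaussInvAcc (2 * sqrt 2 * x) < R * deriv gaussInvAcc 0 := by
  rw [deriv_gaussInvAcc_ray, mul_comm R]
  have hd := deriv_gaussInvAcc_pos 0
  have he : 0 < erfc x ^ 2 := pow_pos (erfc_pos x) 2
  refine mul_lt_mul_of_pos_left ?_ hd
  rw [div_lt_iff₀ he]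
  exact h

/-- `G′(2√2·x) < R·G′(0)` with `R ≥ 1` gives **`2√2·x < critGap R`**. [ours] -/
theorem lt_critGap_of_ray {R x : ℝ} (hR : 1 ≤ R) (h : deriv gaussInvAcc (2 * sqrt 2 * x) < R * deriv gaussInvAcc 0) :
    2 * sqrt 2 * x < critGap R := by
  have hle : 2 * sqrt 2 * x ≤ critGap R := (deriv_le_iff_le_critGap hR _).1 h.le
  rcases hle.eq_or_lt with heq | hlt
  · rw [heq, deriv_critGap_eq hR] at h
    exact absurd h (lt_irrefl _)
  · exact hlt

/-- `erfc` floor from an odd Maclaurin partial sum: `1 − 1.128382·S ≤ erfc x` (`0 ≤ x ≤ 1`, `S ≥ 0`). [ours] -/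
theorem erfc_ge_of_partialSum_odd {x S : ℝ} (hx0 : 0 ≤ x) (hx1 : x ≤ 1) (k : ℕ)
    (hS : ∑ i ∈ range (2 * k + 1), (-1 : ℝ) ^ i * erfTerm x i = S) (hS0 : 0 ≤ S) : 1 - 1.128382 * S ≤ erfc x := by
  have h := erf_le_partialSum_odd hx0 hx1 k
  rw [hS] at h
  have h2 : 2 / sqrt π * S ≤ 1.128382 * S := mul_le_mul_of_nonneg_right two_div_sqrt_pi_lt.le hS0
  rw [erfc_eq_one_sub]
  linarith

/-- `exp` floor: `1 + y + y²/2 + y³/6 + y⁴/24 ≤ e^{y}` for `y ≥ 0`. [folklore] -/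
theorem taylor_five_le_exp {y : ℝ} (hy : 0 ≤ y) : 1 + y + y ^ 2 / 2 + y ^ 3 / 6 + y ^ 4 / 24 ≤ exp y := by
  have h := Real.sum_le_exp_of_nonneg hy 5
  simp only [Finset.sum_range_succ, Finset.sum_range_zero, Nat.factorial] at h
  push_cast at h
  convert h using 1
  ring

/-- Five / seven Maclaurin terms at the six points (exact rationals). [ours] -/
theorem erf_partialSum_lower_points :
    (∑ i ∈ range (2 * 2 + 1), (-1 : ℝ) ^ i * erfTerm (2 / 25) i = 57555411671698 / 720977783203125) ∧
    (∑ i ∈ range (2 * 2 + 1), (-1 : ℝ) ^ i * erfTerm (1 / 5) i = 582843607 / 2953125000) ∧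
    (∑ i ∈ range (2 * 2 + 1), (-1 : ℝ) ^ i * erfTerm (7 / 20) i = 37183087200007 / 110592000000000) ∧
    (∑ i ∈ range (2 * 2 + 1), (-1 : ℝ) ^ i * erfTerm (1 / 2) i = 1785491 / 3870720) ∧
    (∑ i ∈ range (2 * 3 + 1), (-1 : ℝ) ^ i * erfTerm (4 / 5) i = 108489104924924 / 164959716796875) ∧
    (∑ i ∈ range (2 * 3 + 1), (-1 : ℝ) ^ i * erfTerm 1 i = 1614779 / 2162160) := by
  refine ⟨?_, ?_, ?_, ?_, ?_, ?_⟩ <;>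
  · simp only [erfTerm, Finset.sum_range_succ, Finset.sum_range_zero]
    norm_num [Nat.factorial]

/-- `(1.21, 0.08)`: **`G′(2√2·0.08) < 1.21·G′(0)`.** [ours] -/
theorem ray_lower_008 : deriv gaussInvAcc (2 * sqrt 2 * (2 / 25)) < (121 / 100 : ℝ) * deriv gaussInvAcc 0 :=
  deriv_ray_lt (exp_neg_lt_mul_erfc_sq (by norm_num) (by norm_num)
    (erfc_ge_of_partialSum_odd (by norm_num) (by norm_num) 2 erf_partialSum_lower_points.1 (by norm_num))
    (by positivity) (taylor_five_le_exp (by positivity)) (by norm_num))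

/-- `(1.61, 0.2)`: **`G′(2√2·0.2) < 1.61·G′(0)`.** [ours] -/
theorem ray_lower_02 : deriv gaussInvAcc (2 * sqrt 2 * (1 / 5)) < (161 / 100 : ℝ) * deriv gaussInvAcc 0 :=
  deriv_ray_lt (exp_neg_lt_mul_erfc_sq (by norm_num) (by norm_num)
    (erfc_ge_of_partialSum_odd (by norm_num) (by norm_num) 2 erf_partialSum_lower_points.2.1 (by norm_num))
    (by positivity) (taylor_five_le_exp (by positivity)) (by norm_num))

/-- `(2.32, 0.35)`: **`G′(2√2·0.35) < 2.32·G′(0)`.** [ours] -/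
theorem ray_lower_035 : deriv gaussInvAcc (2 * sqrt 2 * (7 / 20)) < (58 / 25 : ℝ) * deriv gaussInvAcc 0 :=
  deriv_ray_lt (exp_neg_lt_mul_erfc_sq (by norm_num) (by norm_num)
    (erfc_ge_of_partialSum_odd (by norm_num) (by norm_num) 2 erf_partialSum_lower_points.2.2.1 (by norm_num))
    (by positivity) (taylor_five_le_exp (by positivity)) (by norm_num))

/-- `(3.43, 0.5)`: **`G′(2√2·0.5) < 3.43·G′(0)`.** [ours] -/
theorem ray_lower_05 : deriv gaussInvAcc (2 * sqrt 2 * (1 / 2)) < (343 / 100 : ℝ) * deriv gaussInvAcc 0 :=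
  deriv_ray_lt (exp_neg_lt_mul_erfc_sq (by norm_num) (by norm_num)
    (erfc_ge_of_partialSum_odd (by norm_num) (by norm_num) 2 erf_partialSum_lower_points.2.2.2.1 (by norm_num))
    (by positivity) (taylor_five_le_exp (by positivity)) (by norm_num))

/-- `(8, 0.8)`: **`G′(2√2·0.8) < 8·G′(0)`.** [ours] -/
theorem ray_lower_08 : deriv gaussInvAcc (2 * sqrt 2 * (4 / 5)) < (8 : ℝ) * deriv gaussInvAcc 0 :=
  deriv_ray_lt (exp_neg_lt_mul_erfc_sq (by norm_num) (by norm_num)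
    (erfc_ge_of_partialSum_odd (by norm_num) (by norm_num) 3 erf_partialSum_lower_points.2.2.2.2.1 (by norm_num))
    (by positivity) (taylor_five_le_exp (by positivity)) (by norm_num))

/-- `(15, 1)`: **`G′(2√2) < 15·G′(0)`.** [ours] -/
theorem ray_lower_1 : deriv gaussInvAcc (2 * sqrt 2 * 1) < (15 : ℝ) * deriv gaussInvAcc 0 :=
  deriv_ray_lt (exp_neg_lt_mul_erfc_sq (by norm_num) (by norm_num)
    (erfc_ge_of_partialSum_odd (by norm_num) (by norm_num) 3 erf_partialSum_lower_points.2.2.2.2.2 (by norm_num))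
    (by positivity) (taylor_five_le_exp (by positivity)) (by norm_num))

end LowerPoints

/-! ## §2 From the weights to the minorant -/

section Weights

variable {K : ℕ}

/-- **`w_max ≥ ((K+1)² − 1)/4`** (`K ≥ 1`; equality for even `K`). [ours] -/
theorem maxPassageWeight_ge (hK : 0 < K) : (((K : ℝ) + 1) ^ 2 - 1) / 4 ≤ maxPassageWeight K := by
  rw [maxPassageWeight_eq]; unfold passageWeight
  set m := (K - 1) / 2 with hm
  have h1 : 2 * m + 1 ≤ K := by omega
  have h2 : K ≤ 2 * m + 2 := by omega
  have h1' : (2 : ℝ) * m + 1 ≤ K := by exact_mod_cast h1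
  have h2' : (K : ℝ) ≤ 2 * m + 2 := by exact_mod_cast h2
  nlinarith [mul_nonneg (sub_nonneg.2 h1') (sub_nonneg.2 h2')]

/-- **`(w_max/w_j)² ≥ η₀·(4t(1−t))^{−2}`** with `t = (j+1)/(K+1)` and `η₀ = (440/441)²`, for `K ≥ 20`. [ours] -/
theorem weightRatio_sq_ge (hK : 20 ≤ K) {j : ℕ} (hj : j < K) :
    (440 / 441 : ℝ) ^ 2 * (1 / (4 * (((j : ℝ) + 1) / ((K : ℝ) + 1)) * (1 - ((j : ℝ) + 1) / ((K : ℝ) + 1))) ^ 2)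
      ≤ (maxPassageWeight K / passageWeight K j) ^ 2 := by
  set t : ℝ := ((j : ℝ) + 1) / ((K : ℝ) + 1) with ht
  have hN : (0 : ℝ) < (K : ℝ) + 1 := by positivity
  have hjK : (j : ℝ) + 1 ≤ K := by exact_mod_cast hj
  have ht0 : 0 < t := by positivity
  have ht1 : t < 1 := by rw [ht, div_lt_one hN]; linarith
  have hprod : 0 < 4 * t * (1 - t) := by nlinarith
  have hw : passageWeight K j = ((K : ℝ) + 1) ^ 2 * (t * (1 - t)) := by
    rw [ht]; unfold passageWeight; field_simp; ring
  have hwpos : 0 < passageWeight K j := passageWeight_pos hj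
  have hmax := maxPassageWeight_ge (K := K) (by omega)
  have hK' : (21 : ℝ) ≤ (K : ℝ) + 1 := by
    have : (20 : ℝ) ≤ K := by exact_mod_cast hK
    linarith
  have heta : (440 / 441 : ℝ) * ((K : ℝ) + 1) ^ 2 ≤ ((K : ℝ) + 1) ^ 2 - 1 := by nlinarith
  have hratio : (440 / 441 : ℝ) * (1 / (4 * t * (1 - t))) ≤ maxPassageWeight K / passageWeight K j := by
    rw [le_div_iff₀ hwpos, hw]
    have ht0' : t ≠ 0 := ht0.ne'
    have h1t : (1 - t) ≠ 0 := by
      have : 0 < 1 - t := by linarith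
      exact this.ne'
    have e0 : (1 / (4 * t * (1 - t))) * (t * (1 - t)) = 1 / 4 := by
      field_simp
    have e : (440 / 441 : ℝ) * (1 / (4 * t * (1 - t))) * (((K : ℝ) + 1) ^ 2 * (t * (1 - t)))
        = (440 / 441 : ℝ) * ((K : ℝ) + 1) ^ 2 * ((1 / (4 * t * (1 - t))) * (t * (1 - t))) := by ring
    rw [e, e0]
    linarith
  have h0 : 0 ≤ (440 / 441 : ℝ) * (1 / (4 * t * (1 - t))) := by positivity
  have := pow_le_pow_left₀ h0 hratio 2
  rw [mul_pow, div_pow (1 : ℝ) (4 * t * (1 - t)) 2, one_pow] at this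
  exact this

/-- Band template (lower): `t ≤ τ ≤ 1/2`, the numeric check `R' ≤ η₀/(4τ(1−τ))²`, and a lower point `G′(2√2x) < R'·G′(0)`
(`R' ≥ 1`) give `2√2·x ≤ critGap((w_max/w_j)²)` for `K ≥ 20`. [ours] -/
theorem critGap_band_lower (hK : 20 ≤ K) {j : ℕ} (hj : j < K) {τ x R' : ℝ}
    (htj : ((j : ℝ) + 1) / ((K : ℝ) + 1) ≤ τ) (hτ : τ ≤ 1 / 2) (hR1 : 1 ≤ R')
    (hR' : R' ≤ (440 / 441 : ℝ) ^ 2 * (1 / (4 * τ * (1 - τ)) ^ 2))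
    (hpt : deriv gaussInvAcc (2 * sqrt 2 * x) < R' * deriv gaussInvAcc 0) :
    2 * sqrt 2 * x ≤ critGap ((maxPassageWeight K / passageWeight K j) ^ 2) := by
  set t : ℝ := ((j : ℝ) + 1) / ((K : ℝ) + 1) with ht
  have ht0 : 0 < t := by positivity
  have hτ0 : 0 < τ := lt_of_lt_of_le ht0 htj
  have hp : 0 < 4 * t * (1 - t) := by nlinarith
  have hmono : 4 * t * (1 - t) ≤ 4 * τ * (1 - τ) := by nlinarith
  have hpτ : 0 < 4 * τ * (1 - τ) := by nlinarith
  have h1 : (1 / (4 * τ * (1 - τ))) ^ 2 ≤ (1 / (4 * t * (1 - t))) ^ 2 := by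
    apply pow_le_pow_left₀ (one_div_nonneg.2 hpτ.le)
    exact one_div_le_one_div_of_le hp hmono
  have h1' : (1 / (4 * τ * (1 - τ)) ^ 2) ≤ 1 / (4 * t * (1 - t)) ^ 2 := by
    rw [div_pow, one_pow, div_pow, one_pow] at h1; exact h1
  have h2 : R' ≤ (maxPassageWeight K / passageWeight K j) ^ 2 :=
    hR'.trans ((mul_le_mul_of_nonneg_left h1' (by norm_num)).trans (weightRatio_sq_ge hK hj))
  exact (lt_critGap_of_ray hR1 hpt).le.trans (critGap_mono h2)

/-- **THE POINTWISE LOWER DOMINATION: `2√2·m(t) ≤ critGap((w_max/w_j)²)`, `t = (j+1)/(K+1)`, for `K ≥ 20`.** [ours] -/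
theorem two_sqrt_two_mul_minorant_le_critGap (hK : 20 ≤ K) {j : ℕ} (hj : j < K) :
    2 * sqrt 2 * indexMinorant (((j : ℝ) + 1) / ((K : ℝ) + 1)) ≤ critGap ((maxPassageWeight K / passageWeight K j) ^ 2) := by
  set t : ℝ := ((j : ℝ) + 1) / ((K : ℝ) + 1) with ht
  have hs : 0 ≤ 2 * sqrt 2 := by positivity
  have hc0 : 0 ≤ critGap ((maxPassageWeight K / passageWeight K j) ^ 2) := critGap_nonneg _
  by_cases h347 : 347 / 1000 < t
  · exact (mul_nonpos_iff.2 (Or.inl ⟨hs, indexMinorant_le_of_gt_347 h347⟩)).trans hc0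
  have h347' : t ≤ 347 / 1000 := not_lt.1 h347
  by_cases h268 : 67 / 250 < t
  · exact (mul_le_mul_of_nonneg_left (indexMinorant_le_of_gt_268 h268) hs).trans
      (critGap_band_lower hK hj h347' (by norm_num) (by norm_num) (by norm_num) ray_lower_008)
  have h268' : t ≤ 67 / 250 := not_lt.1 h268
  by_cases h206 : 103 / 500 < t
  · exact (mul_le_mul_of_nonneg_left (indexMinorant_le_of_gt_206 h206) hs).trans
      (critGap_band_lower hK hj h268' (by norm_num) (by norm_num) (by norm_num) ray_lower_02)
  have h206' : t ≤ 103 / 500 := not_lt.1 h206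
  by_cases h16 : 4 / 25 < t
  · exact (mul_le_mul_of_nonneg_left (indexMinorant_le_of_gt_16 h16) hs).trans
      (critGap_band_lower hK hj h206' (by norm_num) (by norm_num) (by norm_num) ray_lower_035)
  have h16' : t ≤ 4 / 25 := not_lt.1 h16
  by_cases h097 : 97 / 1000 < t
  · exact (mul_le_mul_of_nonneg_left (indexMinorant_le_of_gt_097 h097) hs).trans
      (critGap_band_lower hK hj h16' (by norm_num) (by norm_num) (by norm_num) ray_lower_05)
  have h097' : t ≤ 97 / 1000 := not_lt.1 h097
  by_cases h069 : 69 / 1000 < t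
  · exact (mul_le_mul_of_nonneg_left (indexMinorant_le_of_gt_069 h069) hs).trans
      (critGap_band_lower hK hj h097' (by norm_num) (by norm_num) (by norm_num) ray_lower_08)
  have h069' : t ≤ 69 / 1000 := not_lt.1 h069
  exact (mul_le_mul_of_nonneg_left (indexMinorant_le_one t) hs).trans
    (critGap_band_lower hK hj h069' (by norm_num) (by norm_num) (by norm_num) ray_lower_1)

end Weights

/-! ## §3 The linear lower bound -/

section Linear

variable {K : ℕ}

/-- The mirror terms: `2√2·m(1 − t_j) ≤ critGap((w_max/w_j)²)` as well (`w_{K−1−j} = w_j`). [ours] -/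
theorem two_sqrt_two_mul_minorant_mirror_le_critGap (hK : 20 ≤ K) {j : ℕ} (hj : j < K) :
    2 * sqrt 2 * indexMinorant (1 - ((j : ℝ) + 1) / ((K : ℝ) + 1))
      ≤ critGap ((maxPassageWeight K / passageWeight K j) ^ 2) := by
  have hj' : K - 1 - j < K := by omega
  have h := two_sqrt_two_mul_minorant_le_critGap hK hj'
  have hw : passageWeight K (K - 1 - j) = passageWeight K j := passageWeight_symm hj
  rw [hw] at h
  have e : (((K - 1 - j : ℕ) : ℝ) + 1) / ((K : ℝ) + 1) = 1 - ((j : ℝ) + 1) / ((K : ℝ) + 1) := by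
    have hN : ((K : ℝ) + 1) ≠ 0 := by positivity
    rw [Nat.cast_sub (by omega), Nat.cast_sub (by omega)]
    field_simp
    push_cast
    ring
  rwa [e] at h

/-- **THE LINEAR LOWER BOUND: `Λ_c(K) ≥ 4√2·(0.15772·(K+1) − 1)` for `K ≥ 20`** (for each `j` one of `m(t_j)`, `m(1−t_j)`
vanishes, so `2√2·(m(t_j) + m(1−t_j)) ≤ critGap`; the reflection doubles the one-sided Riemann sum). [ours] -/
theorem thresholdStiffness_ge_linear (hK : 20 ≤ K) :
    4 * sqrt 2 * (0.15772 * ((K : ℝ) + 1) - 1) ≤ thresholdStiffness K := by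
  have hs2 : 0 ≤ 2 * sqrt 2 := by positivity
  have hpt : ∀ j ∈ range K, 2 * sqrt 2 * (indexMinorant (((j : ℝ) + 1) / ((K : ℝ) + 1))
      + indexMinorant (1 - ((j : ℝ) + 1) / ((K : ℝ) + 1))) ≤ critGap ((maxPassageWeight K / passageWeight K j) ^ 2) := by
    intro j hj
    have hjK := mem_range.1 hj
    set t : ℝ := ((j : ℝ) + 1) / ((K : ℝ) + 1) with ht
    have h1 := two_sqrt_two_mul_minorant_le_critGap hK hjK
    have h2 := two_sqrt_two_mul_minorant_mirror_le_critGap hK hjK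
    rw [← ht] at h1 h2
    by_cases hbig : 347 / 1000 < t
    · have hz : indexMinorant t ≤ 0 := indexMinorant_le_of_gt_347 hbig
      have hz' : indexMinorant t = 0 := le_antisymm hz (indexMinorant_mem t).1
      rw [hz', zero_add]; exact h2
    · have hlt : 347 / 1000 < 1 - t := by linarith [not_lt.1 hbig]
      have hz : indexMinorant (1 - t) = 0 := le_antisymm (indexMinorant_le_of_gt_347 hlt) (indexMinorant_mem _).1
      rw [hz, add_zero]; exact h1
  have hsum := sum_le_sum hpt
  have hrefl : ∑ j ∈ range K, indexMinorant (1 - ((j : ℝ) + 1) / ((K : ℝ) + 1))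
      = ∑ j ∈ range K, indexMinorant (((j : ℝ) + 1) / ((K : ℝ) + 1)) := by
    rw [← sum_range_reflect (fun j => indexMinorant (((j : ℝ) + 1) / ((K : ℝ) + 1))) K]
    refine sum_congr rfl fun j hj => ?_
    have hjK := mem_range.1 hj
    have hN : ((K : ℝ) + 1) ≠ 0 := by positivity
    congr 1
    rw [Nat.cast_sub (by omega), Nat.cast_sub (by omega)]
    field_simp
    push_cast
    ring
  have hIcc : ∑ j ∈ range K, indexMinorant (((j : ℝ) + 1) / ((K : ℝ) + 1))
      = ∑ i ∈ Finset.Icc 1 K, indexMinorant ((i : ℝ) / ((K : ℝ) + 1)) := by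
    -- reindex `Σ_{j<K} f(j+1) = Σ_{i ∈ [1, K]} f i` (the lemma is `…AllK.sum_range_succ_eq_sum_Icc`, not imported here)
    have hre : ∀ m : ℕ, ∑ j ∈ range m, indexMinorant ((((j + 1 : ℕ) : ℝ)) / ((K : ℝ) + 1))
        = ∑ i ∈ Finset.Icc 1 m, indexMinorant ((i : ℝ) / ((K : ℝ) + 1)) := by
      intro m
      induction m with
      | zero => simp
      | succ m ih => rw [sum_range_succ, Finset.sum_Icc_succ_top (by omega), ih]
    rw [← hre K]
    refine sum_congr rfl fun j _ => ?_
    push_cast; ring_nf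
  have hs := sum_indexMinorant_ge (N := K + 1) (a := K) (by omega) (by omega)
  push_cast at hs
  have hlhs : ∑ j ∈ range K, 2 * sqrt 2 * (indexMinorant (((j : ℝ) + 1) / ((K : ℝ) + 1))
      + indexMinorant (1 - ((j : ℝ) + 1) / ((K : ℝ) + 1)))
      = 4 * sqrt 2 * ∑ i ∈ Finset.Icc 1 K, indexMinorant ((i : ℝ) / ((K : ℝ) + 1)) := by
    rw [← mul_sum, sum_add_distrib, hrefl, hIcc]; ring
  rw [hlhs] at hsum
  unfold thresholdStiffness
  have hs4 : 0 ≤ 4 * sqrt 2 := by positivity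
  exact (mul_le_mul_of_nonneg_left hs hs4).trans hsum

end Linear

/-! ## §4 Over-resolved flat ladders collapse -/

section Collapse

/-- Six Maclaurin terms at `x = 0.23`. [ours] -/
theorem erf_partialSum_six_023 : ∑ i ∈ range (2 * 3), (-1 : ℝ) ^ i * erfTerm (23 / 100) i
    = 187948164947360225883972599 / 831600000000000000000000000 := by
  simp only [erfTerm, Finset.sum_range_succ, Finset.sum_range_zero]
  norm_num [Nat.factorial]

/-- **`erfc 0.23 < 3/4`.** [ours] -/
theorem erfc_023_lt : erfc (23 / 100) < (3 / 4 : ℝ) := by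
  have h := partialSum_even_le_erf (x := 23 / 100) (by norm_num) (by norm_num) 3
  rw [erf_partialSum_six_023] at h
  have h2 : (1.12836 : ℝ) * (187948164947360225883972599 / 831600000000000000000000000)
      ≤ 2 / sqrt π * (187948164947360225883972599 / 831600000000000000000000000 : ℝ) :=
    mul_le_mul_of_nonneg_right lt_two_div_sqrt_pi.le (by norm_num)
  rw [erfc_eq_one_sub]
  norm_num at h2 ⊢
  linarith

/-- **A pair with model acceptance `≥ 3/4` has gap `< 2√2·0.23`.** [ours] -/
theorem gap_lt_of_gaussAcc_ge {ℓ : ℝ} (h : 3 / 4 ≤ gaussAcc ℓ) : ℓ < 2 * sqrt 2 * (23 / 100) := by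
  have hval : gaussAcc (2 * sqrt 2 * (23 / 100)) = erfc (23 / 100) := by
    unfold gaussAcc
    have hs : (2 : ℝ) * sqrt 2 ≠ 0 := by positivity
    rw [show 2 * sqrt 2 * (23 / 100) / (2 * sqrt 2) = (23 / 100 : ℝ) by field_simp]
  by_contra hcon
  rw [not_lt] at hcon
  have hmono := strictAnti_gaussAcc.antitone hcon
  rw [hval] at hmono
  linarith [erfc_023_lt]

/-- **`K ≥ 20` gaps, all with model acceptance `≥ 3/4` ⇒ `Σ_j ℓ_j ≤ Λ_c(K)`** (`0.23·2√2·K < 4√2(0.15772(K+1) − 1) ⇔ K > 19.7`). [ours] -/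
theorem sum_gap_le_thresholdStiffness_of_acc_ge {K : ℕ} (hK : 20 ≤ K) {ℓ : ℕ → ℝ}
    (h : ∀ j, j < K → 3 / 4 ≤ gaussAcc (ℓ j)) : ∑ j ∈ range K, ℓ j ≤ thresholdStiffness K := by
  have hs : 0 < sqrt 2 := by positivity
  have hK' : (20 : ℝ) ≤ K := by exact_mod_cast hK
  have h1 : ∑ j ∈ range K, ℓ j ≤ ∑ _j ∈ range K, 2 * sqrt 2 * (23 / 100) :=
    sum_le_sum fun j hj => (gap_lt_of_gaussAcc_ge (h j (mem_range.1 hj))).le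
  rw [sum_const, card_range, nsmul_eq_mul] at h1
  have h2 := thresholdStiffness_ge_linear hK
  nlinarith

/-- **COLLAPSE OF OVER-RESOLVED FLAT LADDERS: for `K ≥ 20` gaps all with model acceptance `≥ 3/4`, no positive gap vector of the
same total stiffness is `τ_int`-optimal, and every closed-simplex minimiser has a zero gap.** [ours] -/
theorem collapse_of_acc_ge {K : ℕ} (hK : 20 ≤ K) {ℓ : ℕ → ℝ} (h : ∀ j, j < K → 3 / 4 ≤ gaussAcc (ℓ j)) :
    (∀ v ∈ gapSimplex K (∑ j ∈ range K, ℓ j), ¬ IsMinOn (gapIndexCost K) (gapSimplex K (∑ j ∈ range K, ℓ j)) v) ∧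
    (∀ v ∈ closedGapSimplex K (∑ j ∈ range K, ℓ j),
      IsMinOn (finIndexCost K) (closedGapSimplex K (∑ j ∈ range K, ℓ j)) v → ∃ i : Fin K, v i = 0) := by
  have hle := sum_gap_le_thresholdStiffness_of_acc_ge hK h
  have hK0 : 0 < K := by omega
  exact ⟨fun v hv => not_isMinOn_of_le_thresholdStiffness hK0 hle hv,
    fun v hv hmin => exists_gap_eq_zero_of_le_thresholdStiffness hK0 hle hv hmin⟩

end Collapse

end Summit.Ventures.LatticeQCDFlow.Scaling

end
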